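import Literature.AlgebraicGeometry.Resolution.NormalDegreePDefectless
import Literature.AlgebraicGeometry.Resolution.GeneralizedStabilityHenselizedRational
import HarnessLib

/-!
# Normal extensions of degree `p` of `K(x)^h` with a value-transcendental generator: the two cases (Kuhlmann 2010, Cor. 4.2 / Props. 4.5–4.6, Prop. 3.1)

Topic: `Literature/AlgebraicGeometry/Resolution` (valued function fields). Value-transcendental
twin of `NormalDegreePDefectless.lean` (which serves the residue-transcendental class
`IsHenselizedInertiallyGeneratedRT`), and first layer of the decomposition of the named fact
`Kuhlmann2010HenselizedRationalImmediateExt` (`GeneralizedStabilityHenselizedRational.lean`) =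
the italicized statement on p. 19 of F.-V. Kuhlmann, *Elimination of ramification I: The
generalized stability theorem*, Trans. AMS 362 (2010) 5697–5727 = arXiv:1003.5678, for the
henselized rational function field `F = K(x)^h` of rank one with a value-transcendental
generator over an algebraically closed `K`:

> Consequently, `E.F^r|F^r` is a finite tower of normal extensions of degree `p`, either
> Galois or purely inseparable. Then there is already a finite subextension `N|F` of `F^r|F`
> such that `E.N|N` is such a tower. Lemma 2.27 shows that `N`, being a finite subextension
> inside `F^r`, is again a henselized inertially generated function field of transcendence
> degree 1 with a valuation-transcendental generator over `K`. Also, it is again of rank 1. …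
> Then the first extension in the tower is defectless by Corollary 4.2 or Proposition 3.1. This
> yields `d(E|F,v) = d(E.N|N,v) < [E.N:N] ≤ [E:F]`, that is, `(E|F,v)` cannot be immediate.

In the value-transcendental case Lemma 2.27 reads "If `(F|K,v)` is a henselized rational
function field with value-transcendental generator, then so is `(E|K,v)`" (Lemma 2.26: over an
algebraically closed `K` a henselized inertially generated function field with a
value-transcendental generator IS henselized rational), so the degree-`p` steps to which
Cor. 4.2 / Prop. 3.1 are applied are normal extensions of degree `p` of fields `N = K(y)^h` of
rank one with `y` value-transcendental over `K` — the form (4.2) of §4: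
"`F = K(x)^h` is of rank 1 and `x` is value-transcendental over `K`. In this case, `F̄ = K̄` and
`vF = vK ⊕ ℤvx`." A normal extension of prime degree is Galois or purely inseparable
(`IsNormalStep.isGaloisStep_or_isPurelyInseparableStep`, `NormalDegreePDefectless.lean`); the
Galois steps are Cor. 4.2, proved for the form (4.2) by the Artin–Schreier and Kummer normal
forms of Prop. 4.5 (`char K = p`) and Prop. 4.6 (`char K = 0`) of §4.1, the purely inseparable
steps are Prop. 3.1 (the "inseparably defectless" version of Thm. 1.1) transported to the
henselization by Thm. 2.14.

## Content

* NAMED FACTS, each in the form in which pp. 19–20 consume it, in the ambient rendering of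
  `GeneralizedStabilityHenselizedRational.lean` (one algebraically closed valued field
  `(Ω, V)`, `K ≤ Ω` an algebraically closed subfield, `N = K(y)^h = henselizedAdjoin V K y`
  with `y` value-transcendental over `K` and `(N, V ∩ N)` of rank one):
  `Kuhlmann2010GaloisDegreePDefectlessVT` (Cor. 4.2 with Props. 4.5–4.6),
  `Kuhlmann2010PurelyInseparableDegreePDefectlessVT` (Prop. 3.1 with Thm. 2.14).
* `isDefectlessExtension_of_isNormalStep_henselizedAdjoin` — "the first extension in the tower
  is defectless by Corollary 4.2 or Proposition 3.1" for `N = K(y)^h`: a normal step of degree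
  `p` over `N` is defectless, from the two named facts. PROVED.

## Sources

* F.-V. Kuhlmann, *Elimination of ramification I: The generalized stability theorem*, Trans.
  Amer. Math. Soc. 362 (2010) 5697–5727 = arXiv:1003.5678: §2.3 (defect, Thm. 2.14), §2.5
  (henselized rational function fields, value-transcendental generators, Lemmas 2.26–2.27),
  §3 Prop. 3.1, §4 ((4.1), (4.2), Prop. 4.1, Cor. 4.2, Lemma 4.4, Props. 4.5–4.6), §5 proof of
  (R4), pp. 18–20.

## Rendering notes

* "`E'|N` normal of degree `p`" = `IsNormalStep p N E'` (`HenselizedFunctionFields.lean`), split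
  into `IsGaloisStep` / `IsPurelyInseparableStep` (`NormalDegreePDefectless.lean`); "defectless"
  = `IsDefectlessExtension V N E'` (`[E' : N] = (vE' : vN)·[E'v : Nv]` for the extension
  `V ∩ E'`, the unique one over the henselian `N = K(y)^h`, §1.1 / Lemma 2.3).
* Cor. 4.2 is printed for "`(F|K,v)` a henselized inertially generated function field of
  transcendence degree 1 and rank 1" with "`(K,v)` a defectless field", under the standing
  hypothesis (4.1) of §4 ("`(K,v)` is henselian and `p = char K̄ > 0`, and `K` is closed under
  `p`-th roots") and for `F` of the form (4.2) or (4.3). An algebraically closed subfield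
  `K ≤ Ω` with the restriction of `V` is henselian, closed under `p`-th roots and defectless (it
  has no proper algebraic extension), and `K(y)^h` of rank one with `y` value-transcendental is
  the form (4.2). The fact is vendored in this specialisation — the one pp. 19–20 use (there `K`
  is algebraically closed by the reduction (R2) of Lemma 5.2) —; nothing is claimed for fields
  the source does not cover. For the form (4.2) the source proves more than defectlessness:
  Prop. 4.5 ("If (4.6) does not hold, then `(vE:vF) = p` and the extension `(E|F,v)` is
  defectless"; (4.6), `E = F(ϑ)` with `ϑ^p − ϑ ∈ K`, is impossible over an algebraically closed
  `K`) and Prop. 4.6 ("In both cases, `(vE:vF) = p`"); only the printed corollary is vendored.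
* Prop. 3.1 is printed for valued function fields `(F|K,v)` without transcendence defect over
  an inseparably defectless `(K,v)`; pp. 19–20 apply it to the henselized field `N = K(y)^h`
  through Thm. 2.14 ("The same holds for … 'inseparably defectless' in the place of
  'defectless'"): `K(y)|K` has transcendence degree `1 = rr(vK(y)/vK)`, no transcendence
  defect (Lemma 2.5), and an algebraically closed `K` is inseparably defectless; so `K(y)^h` is
  inseparably defectless, i.e. defectless in every finite purely inseparable extension, for
  the unique extension of its valuation.
* What is NOT here: the proofs (§3, §4.1 of the source: Lemma 4.4 — density of `K[x,x⁻¹]` in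
  `K(x)^h` for rank one —, Artin–Schreier and Kummer theory, Lemmas 2.9–2.10, Cor. 2.11), and
  the assembly of `Kuhlmann2010HenselizedRationalImmediateExt` from these facts (sibling files).
-/

noncomputable section

open IsLocalRing

namespace Literature.AlgebraicGeometry.Resolution

universe u

/-! ### The two cases as named facts -/

/-- NAMED FACT — **Kuhlmann 2010, Cor. 4.2 in the value-transcendental case (4.2): Galois
extensions of degree `p` of `K(x)^h` are defectless.** Cor. 4.2: "Let `(F|K,v)` be a henselized
inertially generated function field of transcendence degree 1 and rank 1. If `(K,v)` is a
defectless field, then every Galois extension `(E|F,v)` of degree `p` is defectless" — under the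
standing hypothesis (4.1) of §4 ("`(K,v)` is henselian and `p = char K̄ > 0`, and `K` is closed
under `p`-th roots") and for `F` of the form (4.2) ("`F = K(x)^h` is of rank 1 and `x` is
value-transcendental over `K`") or (4.3); it follows from Prop. 4.1, proved for the form (4.2) in
§4.1 by the normal forms of Prop. 4.5 (`char K = p`: "either `E = F(ϑ)` where `ϑ^p − ϑ ∈ K`, or
`E = F(ϑ)` where `ϑ^p − ϑ = c₀ + ∑_{i∈I} cᵢxⁱ` … If (4.6) does not hold, then `(vE:vF) = p` and
the extension `(E|F,v)` is defectless") and Prop. 4.6 (`char K = 0`: "`E = F(ϑ)` where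
`ϑ^p = x^m u` … In both cases, `(vE:vF) = p`"), which rest on Lemma 4.4 ("`R = K[x,x⁻¹]` is dense
in `F`"), Artin–Schreier and Kummer theory and Lemmas 2.9–2.10, Cor. 2.11. Rendering (the case
pp. 19–20 use, with Lemmas 2.26–2.27): `(Ω, V)` algebraically closed with `char Ωv = p > 0`,
`K ≤ Ω` a subfield which is an algebraically closed field — hence henselian, closed under `p`-th
roots and defectless —, `y ∈ Ω` value-transcendental over `K` (`IsValueTranscendentalOver`),
`N = K(y)^h = henselizedAdjoin V K y` of rank one (`IsRankOneValued`), `N ≤ N'` Galois of degree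
`p` (`IsGaloisStep`); then `(N'|N, v)` is defectless (`IsDefectlessExtension`:
`p = [N' : N] = (vN' : vN)·[N'v : Nv]`). Its proof is §4.1 of the source, not in Mathlib. Users
take `(h : Kuhlmann2010GaloisDegreePDefectlessVT)`.
[cite: Kuhlmann2010, Cor. 4.2 (with Prop. 4.1, Props. 4.5–4.6, Section 5 pp. 19–20)] -/
def Kuhlmann2010GaloisDegreePDefectlessVT : Prop :=
  ∀ (Ω : Type u) [Field Ω] [IsAlgClosed Ω] (V : ValuationSubring Ω) (p : ℕ) [CharP (ResidueField V) p],
    p.Prime → ∀ (K : Subfield Ω), IsAlgClosed K → ∀ y : Ω, IsValueTranscendentalOver V K y →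
    IsRankOneValued V (henselizedAdjoin V K y) →
    ∀ N' : Subfield Ω, IsGaloisStep p (henselizedAdjoin V K y) N' →
      IsDefectlessExtension V (henselizedAdjoin V K y) N'

/-- NAMED FACT — **Kuhlmann 2010, Prop. 3.1 with Thm. 2.14, in the value-transcendental case:
purely inseparable extensions of degree `p` of `K(x)^h` are defectless.** Prop. 3.1: "Let
`(F|K,v)` be a valued function field without transcendence defect. If `(K,v)` is an inseparably
defectless field, then so is `(F,v)`"; Thm. 2.14: "`(K,v)` is defectless if and only if its
henselization `(K,v)^h` in `(K̃,v)` is defectless. The same holds for 'separably defectless' and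
'inseparably defectless' in the place of 'defectless'." On pp. 19–20 ("the first extension in the
tower is defectless by Corollary 4.2 or Proposition 3.1"; "By Corollary 4.2 or Proposition 3.1,
this extension is defectless") they are applied to a purely inseparable normal step of degree `p`
over `N = K(y)^h`, the henselization of the rational function field `K(y)|K` of transcendence
degree `1 = rr(vK(y)/vK)` without transcendence defect (`y` value-transcendental, Lemma 2.5)
over the algebraically closed, hence inseparably defectless, `K`: so `(N, v)` is inseparably
defectless, i.e. defectless in every finite purely inseparable extension, for the unique
extension of the valuation of the henselian `N`. Rendering: `(Ω, V)` algebraically closed with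
`char Ωv = p > 0`, `K ≤ Ω` an algebraically closed subfield, `y ∈ Ω` value-transcendental over
`K`, `N = henselizedAdjoin V K y` of rank one, `N ≤ N'` purely inseparable of degree `p`
(`IsPurelyInseparableStep`); then `IsDefectlessExtension V N N'`. Users take
`(h : Kuhlmann2010PurelyInseparableDegreePDefectlessVT)`.
[cite: Kuhlmann2010, Prop. 3.1 and Thm. 2.14 (with Section 5 pp. 19–20)] -/
def Kuhlmann2010PurelyInseparableDegreePDefectlessVT : Prop :=
  ∀ (Ω : Type u) [Field Ω] [IsAlgClosed Ω] (V : ValuationSubring Ω) (p : ℕ) [CharP (ResidueField V) p],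
    p.Prime → ∀ (K : Subfield Ω), IsAlgClosed K → ∀ y : Ω, IsValueTranscendentalOver V K y →
    IsRankOneValued V (henselizedAdjoin V K y) →
    ∀ N' : Subfield Ω, IsPurelyInseparableStep p (henselizedAdjoin V K y) N' →
      IsDefectlessExtension V (henselizedAdjoin V K y) N'

/-! ### Normal steps of degree `p` over `K(y)^h` -/

/-- **Kuhlmann 2010, pp. 19–20, "the first extension in the tower is defectless by Corollary 4.2
or Proposition 3.1"**, for a normal extension of degree `p` of `N = K(y)^h` of rank one with `y`
value-transcendental over the algebraically closed `K`: a normal step of prime degree `p` is a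
Galois step (Cor. 4.2, `Kuhlmann2010GaloisDegreePDefectlessVT`) or a purely inseparable step
(Prop. 3.1 with Thm. 2.14, `Kuhlmann2010PurelyInseparableDegreePDefectlessVT`). PROVED from the
two named facts. [cite: Kuhlmann2010, Section 5, proof of (R4) (pp. 19–20)] -/
theorem isDefectlessExtension_of_isNormalStep_henselizedAdjoin
    (hG : Kuhlmann2010GaloisDegreePDefectlessVT.{u})
    (hI : Kuhlmann2010PurelyInseparableDegreePDefectlessVT.{u})
    {Ω : Type u} [Field Ω] [IsAlgClosed Ω] (V : ValuationSubring Ω) {p : ℕ} [CharP (ResidueField V) p]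
    (hp : p.Prime) {K : Subfield Ω} (hK : IsAlgClosed K) {y : Ω} (hy : IsValueTranscendentalOver V K y)
    (hr : IsRankOneValued V (henselizedAdjoin V K y)) {N' : Subfield Ω}
    (hstep : IsNormalStep p (henselizedAdjoin V K y) N') :
    IsDefectlessExtension V (henselizedAdjoin V K y) N' := by
  rcases hstep.isGaloisStep_or_isPurelyInseparableStep hp with hg | hi
  · exact hG Ω V p hp K hK y hy hr N' hg
  · exact hI Ω V p hp K hK y hy hr N' hi

end Literature.AlgebraicGeometry.Resolution
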